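import Summits.Ventures.CertifiedManyBodySolver.Downfold.EmeryBandReductionAcrossCu
import Literature.Analysis.ValidatedNumerics.IntervalFunctions
import HarnessLib

/-!
# Rational interval images of the technique-B map on a three-band box: corner values with a
# certified square root, the Δ-subdivided `t′` enclosure, inclusion theorems

Venture CertifiedManyBodySolver, cell `pub/hubbard-downfold` (stage S1 = downfolding front end), seat
hubbard-downfold-mod-4; namespace `Summit.Ventures.CertifiedManyBodySolver.Downfold.Emery`. Everything
here is PROVED. WHAT THIS IS NOT: a statement about any material; no literature number here; the
La₂CuO₄ evaluation of these maps is SCREENING-GRADE input ↦ certified arithmetic and lives in the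
cell (`router/BOXES/La2CuO4-family.md §REDUCTION-B`).

A parameter BOX has RATIONAL end points (`Downfold.ParameterBox`); the closed-form antibonding
energies carry a square root. This file evaluates the corner and mixed-corner rules of
`EmeryBandReduction(AcrossCu)` at rational corners with the tree's certified Heron bounds
`sqrtDown ≤ √ ≤ sqrtUp` (`Literature.Analysis.ValidatedNumerics.IntervalFunctions`):

* §1 `abXlo/abXhi`, `abMlo/abMhi`, `abSlo/abShi` with `abXlo_le : abXlo ≤ abX`, … at rational points.
* §2 `tpB_mono_tpd_of` — `t′_B` is MONOTONE in `t_pd` on `0 < a₁ ≤ a₂` whenever `t_pp · Δ ≤ 2 a₁²`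
  (the cuprate regime; exact algebra: `2(√X₂ − √X₁) ≥ √M₂ − √M₁` because `M_i ≥ X_i`), and the
  one-piece enclosure `tpB_mem_Icc_piece` using EXACT corners in `t_pd`, `t_pp` and mixed corners
  in the shifted `Δ′ = Δ + 4t_pp′` only. Reviewer unc-3 (R4) asked for the mixed-corner rule with
  optional Δ-splitting; the fully decorrelated rule is too wide to sign `t′` on a cuprate box, the
  split rule with exact `t_pd`, `t_pp` corners converges to the true image.
* §3 Interval images with `n + 1` uniform pieces of `Δ′`: `tI` (corner rule, exact up to `√`
  rounding), `tpIk` (hull over pieces of §2, falling back to decorrelated `t_pd` corners when the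
  regime condition fails on a piece — decided on the rationals), `tppI` (mixed corners; `t″` is not
  load-bearing); inclusion theorems `tB4_mem_tI`, `tpB4_mem_tpIk`, `tppB4_mem_tppI` under
  `0 < A.fst` (sign convention `t_pd > 0`).

The box-level typed statement consuming these: `Downfold.ThreeToOneBand`.
-/

noncomputable section

namespace Summit.Ventures.CertifiedManyBodySolver.Downfold.Emery

open Real NonemptyInterval Literature.Analysis.ValidatedNumerics

/-! ## §1 Rational corner values of the antibonding energies -/

/-- A rational interval from two end-point candidates, total (`[lo, max lo hi]`). [folklore] -/
def mkI (lo hi : ℚ) : NonemptyInterval ℚ := ⟨(lo, max lo hi), le_max_left _ _⟩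

/-- Membership in `mkI lo hi` from the two real inequalities. [folklore] -/
theorem mem_mkI {lo hi : ℚ} {x : ℝ} (h1 : (lo : ℝ) ≤ x) (h2 : x ≤ hi) : x ∈ (mkI lo hi).ratCast ℝ := by
  rw [mem_ratCast_iff]
  refine ⟨h1, ?_⟩
  simp only [mkI, Rat.cast_max]
  exact h2.trans (le_max_right _ _)

/-- Rational LOWER bound of `abX Δ a = (−Δ + √(Δ² + 16a²))/2` (certified `sqrtDown`). [folklore] -/
def abXlo (prec k : ℕ) (Δ a : ℚ) : ℚ := (-Δ + sqrtDown prec k (Δ ^ 2 + 16 * a ^ 2)) / 2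

/-- Rational UPPER bound of `abX Δ a` (certified `sqrtUp`). [folklore] -/
def abXhi (prec k : ℕ) (Δ a : ℚ) : ℚ := (-Δ + sqrtUp prec k (Δ ^ 2 + 16 * a ^ 2)) / 2

/-- Rational LOWER bound of `abM Δ a b = (−Δ + 4b + √((Δ − 4b)² + 32a²))/2`. [folklore] -/
def abMlo (prec k : ℕ) (Δ a b : ℚ) : ℚ :=
  (-Δ + 4 * b + sqrtDown prec k ((Δ - 4 * b) ^ 2 + 32 * a ^ 2)) / 2

/-- Rational UPPER bound of `abM Δ a b`. [folklore] -/
def abMhi (prec k : ℕ) (Δ a b : ℚ) : ℚ :=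
  (-Δ + 4 * b + sqrtUp prec k ((Δ - 4 * b) ^ 2 + 32 * a ^ 2)) / 2

/-- Rational LOWER bound of `abS Δ a b = (−Δ + 2b + √((Δ − 2b)² + 16a²))/2`. [folklore] -/
def abSlo (prec k : ℕ) (Δ a b : ℚ) : ℚ :=
  (-Δ + 2 * b + sqrtDown prec k ((Δ - 2 * b) ^ 2 + 16 * a ^ 2)) / 2

/-- Rational UPPER bound of `abS Δ a b`. [folklore] -/
def abShi (prec k : ℕ) (Δ a b : ℚ) : ℚ :=
  (-Δ + 2 * b + sqrtUp prec k ((Δ - 2 * b) ^ 2 + 16 * a ^ 2)) / 2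

/-- `abXlo ≤ abX` at a rational point. [folklore] -/
theorem abXlo_le (prec k : ℕ) (Δ a : ℚ) : (abXlo prec k Δ a : ℝ) ≤ abX Δ a := by
  have h := sqrtDown_le_sqrt prec k (q := Δ ^ 2 + 16 * a ^ 2) (x := (Δ : ℝ) ^ 2 + 16 * (a : ℝ) ^ 2)
    (by positivity) (by push_cast; exact le_rfl)
  unfold abXlo abX; push_cast; linarith

/-- `abX ≤ abXhi` at a rational point. [folklore] -/
theorem le_abXhi (prec k : ℕ) (Δ a : ℚ) : abX Δ a ≤ (abXhi prec k Δ a : ℝ) := by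
  have h := sqrt_le_sqrtUp prec k (q := Δ ^ 2 + 16 * a ^ 2) (x := (Δ : ℝ) ^ 2 + 16 * (a : ℝ) ^ 2)
    (by positivity) (by push_cast; exact le_rfl)
  unfold abXhi abX; push_cast; linarith

/-- `abMlo ≤ abM` at a rational point. [folklore] -/
theorem abMlo_le (prec k : ℕ) (Δ a b : ℚ) : (abMlo prec k Δ a b : ℝ) ≤ abM Δ a b := by
  have h := sqrtDown_le_sqrt prec k (q := (Δ - 4 * b) ^ 2 + 32 * a ^ 2)
    (x := ((Δ : ℝ) - 4 * b) ^ 2 + 32 * (a : ℝ) ^ 2) (by positivity) (by push_cast; exact le_rfl)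
  unfold abMlo abM; push_cast; linarith

/-- `abM ≤ abMhi` at a rational point. [folklore] -/
theorem le_abMhi (prec k : ℕ) (Δ a b : ℚ) : abM Δ a b ≤ (abMhi prec k Δ a b : ℝ) := by
  have h := sqrt_le_sqrtUp prec k (q := (Δ - 4 * b) ^ 2 + 32 * a ^ 2)
    (x := ((Δ : ℝ) - 4 * b) ^ 2 + 32 * (a : ℝ) ^ 2) (by positivity) (by push_cast; exact le_rfl)
  unfold abMhi abM; push_cast; linarith

/-- `abSlo ≤ abS` at a rational point. [folklore] -/
theorem abSlo_le (prec k : ℕ) (Δ a b : ℚ) : (abSlo prec k Δ a b : ℝ) ≤ abS Δ a b := by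
  have h := sqrtDown_le_sqrt prec k (q := (Δ - 2 * b) ^ 2 + 16 * a ^ 2)
    (x := ((Δ : ℝ) - 2 * b) ^ 2 + 16 * (a : ℝ) ^ 2) (by positivity) (by push_cast; exact le_rfl)
  unfold abSlo abS; push_cast; linarith

/-- `abS ≤ abShi` at a rational point. [folklore] -/
theorem le_abShi (prec k : ℕ) (Δ a b : ℚ) : abS Δ a b ≤ (abShi prec k Δ a b : ℝ) := by
  have h := sqrt_le_sqrtUp prec k (q := (Δ - 2 * b) ^ 2 + 16 * a ^ 2)
    (x := ((Δ : ℝ) - 2 * b) ^ 2 + 16 * (a : ℝ) ^ 2) (by positivity) (by push_cast; exact le_rfl)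
  unfold abShi abS; push_cast; linarith

/-! ## §2 `t′` is monotone in `t_pd` in the cuprate regime; one-piece enclosure -/

/-- **`t′_B` is MONOTONE in `t_pd`** on `0 < a₁ ≤ a₂` whenever `t_pp · Δ ≤ 2 a₁²` (then
`M_i = (Δ − 4b)² + 32a_i² ≥ X_i = Δ² + 16a_i²`, so `√X₂ − √X₁ = 16δ/(√X₁ + √X₂) ≥ 16δ/(√M₁ + √M₂)
= (√M₂ − √M₁)/2`, `δ = a₂² − a₁²`). [folklore] -/
theorem tpB_mono_tpd_of {Δ a₁ a₂ b : ℝ} (h0 : 0 < a₁) (h12 : a₁ ≤ a₂) (hc : b * Δ ≤ 2 * a₁ ^ 2) :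
    tpB Δ a₁ b ≤ tpB Δ a₂ b := by
  unfold tpB abX abM
  set X₁ := Δ ^ 2 + 16 * a₁ ^ 2 with hX₁
  set X₂ := Δ ^ 2 + 16 * a₂ ^ 2 with hX₂
  set M₁ := (Δ - 4 * b) ^ 2 + 32 * a₁ ^ 2 with hM₁
  set M₂ := (Δ - 4 * b) ^ 2 + 32 * a₂ ^ 2 with hM₂
  have ha2 : a₁ ^ 2 ≤ a₂ ^ 2 := by nlinarith
  have hX₁pos : 0 < X₁ := by positivity
  have hXM₁ : X₁ ≤ M₁ := by nlinarith [sq_nonneg b]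
  have hXM₂ : X₂ ≤ M₂ := by nlinarith [sq_nonneg b]
  have hM12 : M₁ ≤ M₂ := by nlinarith
  have sX₁ : Real.sqrt X₁ ^ 2 = X₁ := Real.sq_sqrt hX₁pos.le
  have sX₂ : Real.sqrt X₂ ^ 2 = X₂ := Real.sq_sqrt (by positivity)
  have sM₁ : Real.sqrt M₁ ^ 2 = M₁ := Real.sq_sqrt (by positivity)
  have sM₂ : Real.sqrt M₂ ^ 2 = M₂ := Real.sq_sqrt (by positivity)
  have gX₁ : 0 < Real.sqrt X₁ := Real.sqrt_pos.2 hX₁pos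
  have gX₂ : 0 ≤ Real.sqrt X₂ := Real.sqrt_nonneg _
  have gM₁ : 0 ≤ Real.sqrt M₁ := Real.sqrt_nonneg _
  have leXM₁ : Real.sqrt X₁ ≤ Real.sqrt M₁ := Real.sqrt_le_sqrt hXM₁
  have leXM₂ : Real.sqrt X₂ ≤ Real.sqrt M₂ := Real.sqrt_le_sqrt hXM₂
  have leM : Real.sqrt M₁ ≤ Real.sqrt M₂ := Real.sqrt_le_sqrt hM12
  -- products of differences and sums
  have pX : (Real.sqrt X₂ - Real.sqrt X₁) * (Real.sqrt X₂ + Real.sqrt X₁) = 16 * (a₂ ^ 2 - a₁ ^ 2) := by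
    nlinarith [sX₁, sX₂]
  have pM : (Real.sqrt M₂ - Real.sqrt M₁) * (Real.sqrt M₂ + Real.sqrt M₁) = 32 * (a₂ ^ 2 - a₁ ^ 2) := by
    nlinarith [sM₁, sM₂]
  -- goal: (2(−Δ+√X₁) ... ) form; reduce to √M₂ − √M₁ ≤ 2(√X₂ − √X₁)
  have key : Real.sqrt M₂ - Real.sqrt M₁ ≤ 2 * (Real.sqrt X₂ - Real.sqrt X₁) := by
    by_contra hlt
    push Not at hlt
    have hsum : 0 < Real.sqrt X₂ + Real.sqrt X₁ := by linarith
    -- 32δ = (√M₂−√M₁)(√M₂+√M₁) ≥ (√M₂−√M₁)(√X₂+√X₁) > 2(√X₂−√X₁)(√X₂+√X₁) = 32δ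
    have hMd : 0 ≤ Real.sqrt M₂ - Real.sqrt M₁ := by linarith
    have h1 : (Real.sqrt M₂ - Real.sqrt M₁) * (Real.sqrt X₂ + Real.sqrt X₁)
        ≤ (Real.sqrt M₂ - Real.sqrt M₁) * (Real.sqrt M₂ + Real.sqrt M₁) :=
      mul_le_mul_of_nonneg_left (by linarith) hMd
    have h2 : 2 * (Real.sqrt X₂ - Real.sqrt X₁) * (Real.sqrt X₂ + Real.sqrt X₁)
        < (Real.sqrt M₂ - Real.sqrt M₁) * (Real.sqrt X₂ + Real.sqrt X₁) := by
      have := mul_lt_mul_of_pos_right hlt hsum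
      linarith
    nlinarith [pX, pM, h1, h2]
  linarith

/-- **One-piece enclosure of `t′_B` with EXACT `t_pd`, `t_pp` corners** (mixed only in `Δ′`): on
`[d₁,d₂] × [alo,ahi] × [blo,bhi] ∋ (Δ′, a, b)` with `0 < alo` and the regime conditions
`max (bhi·d₁) (bhi·d₂) ≤ 2alo²` (lower chain), `max (blo·d₁) (blo·d₂) ≤ 2alo²` (upper chain):
`t′_B ∈ [(2abX(d₂,alo) − abM(d₁,alo,bhi))/16, (2abX(d₁,ahi) − abM(d₂,ahi,blo))/16]`. [folklore] -/
theorem tpB_mem_Icc_piece {d₁ d₂ alo ahi blo bhi Δ a b : ℝ} (ha : 0 < alo)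
    (hΔ : Δ ∈ Set.Icc d₁ d₂) (ha' : a ∈ Set.Icc alo ahi) (hb' : b ∈ Set.Icc blo bhi)
    (hlo : max (bhi * d₁) (bhi * d₂) ≤ 2 * alo ^ 2) (hhi : max (blo * d₁) (blo * d₂) ≤ 2 * alo ^ 2) :
    tpB Δ a b ∈ Set.Icc ((2 * abX d₂ alo - abM d₁ alo bhi) / 16)
      ((2 * abX d₁ ahi - abM d₂ ahi blo) / 16) := by
  -- b·Δ on [d₁,d₂] is bounded by the max of the end-point values (linear in Δ)
  have lin : ∀ β : ℝ, β * Δ ≤ max (β * d₁) (β * d₂) := by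
    intro β
    rcases le_total 0 β with hβ | hβ
    · exact (mul_le_mul_of_nonneg_left hΔ.2 hβ).trans (le_max_right _ _)
    · exact (mul_le_mul_of_nonpos_left hΔ.1 hβ).trans (le_max_left _ _)
  have c_lo : bhi * Δ ≤ 2 * alo ^ 2 := (lin bhi).trans hlo
  have c_hi : blo * Δ ≤ 2 * alo ^ 2 := (lin blo).trans hhi
  constructor
  · -- tpB Δ a b ≥ tpB Δ a bhi ≥ tpB Δ alo bhi ≥ mixed corner in Δ
    have s1 : tpB Δ a bhi ≤ tpB Δ a b := tpB_anti_tpp hb'.2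
    have s2 : tpB Δ alo bhi ≤ tpB Δ a bhi := tpB_mono_tpd_of ha ha'.1 c_lo
    have hX : abX d₂ alo ≤ abX Δ alo := abX_anti_Delta hΔ.2
    have hM : abM Δ alo bhi ≤ abM d₁ alo bhi := abM_anti_Delta hΔ.1
    have s3 : (2 * abX d₂ alo - abM d₁ alo bhi) / 16 ≤ tpB Δ alo bhi := by
      unfold tpB; linarith
    linarith
  · have s1 : tpB Δ a b ≤ tpB Δ a blo := tpB_anti_tpp hb'.1
    have s2 : tpB Δ a blo ≤ tpB Δ ahi blo :=
      tpB_mono_tpd_of (lt_of_lt_of_le ha ha'.1) ha'.2 (c_hi.trans (by nlinarith [ha'.1]))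
    have hX : abX Δ ahi ≤ abX d₁ ahi := abX_anti_Delta hΔ.1
    have hM : abM d₂ ahi blo ≤ abM Δ ahi blo := abM_anti_Delta hΔ.2
    have s3 : tpB Δ ahi blo ≤ (2 * abX d₁ ahi - abM d₂ ahi blo) / 16 := by
      unfold tpB; linarith
    linarith

/-! ## §3 Rational interval images (scale by corners; `t′` by Δ′-pieces; `t″` by mixed corners) -/

/-- **Interval image of `t_B`** on the three-band box `D × A × B × C ∋ (Δ, t_pd, t_pp, t_pp′)`
(CORNER rule, `t_pp′` shifting `Δ` by `4t_pp′`; exact up to `√` rounding: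
`[abMlo(Δhi + 4chi, alo, blo)/8, abMhi(Δlo + 4clo, ahi, bhi)/8]`). [folklore] -/
def tI (prec k : ℕ) (D A B C : NonemptyInterval ℚ) : NonemptyInterval ℚ :=
  mkI (abMlo prec k (D.snd + 4 * C.snd) A.fst B.fst / 8)
    (abMhi prec k (D.fst + 4 * C.fst) A.snd B.snd / 8)

/-- Lower end of the `t′` enclosure on one `Δ′`-piece `[d₁, d₂]` (exact `t_pd`, `t_pp` corners when
the regime condition holds on the rationals, else decorrelated `t_pd`). [folklore] -/
def tpPieceLo (prec k : ℕ) (d₁ d₂ : ℚ) (A B : NonemptyInterval ℚ) : ℚ :=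
  if max (B.snd * d₁) (B.snd * d₂) ≤ 2 * A.fst ^ 2 ∧ max (B.fst * d₁) (B.fst * d₂) ≤ 2 * A.fst ^ 2
  then (2 * abXlo prec k d₂ A.fst - abMhi prec k d₁ A.fst B.snd) / 16
  else (2 * abXlo prec k d₂ A.fst - abMhi prec k d₁ A.snd B.snd) / 16

/-- Upper end of the `t′` enclosure on one `Δ′`-piece `[d₁, d₂]`. [folklore] -/
def tpPieceHi (prec k : ℕ) (d₁ d₂ : ℚ) (A B : NonemptyInterval ℚ) : ℚ :=
  if max (B.snd * d₁) (B.snd * d₂) ≤ 2 * A.fst ^ 2 ∧ max (B.fst * d₁) (B.fst * d₂) ≤ 2 * A.fst ^ 2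
  then (2 * abXhi prec k d₁ A.snd - abMlo prec k d₂ A.snd B.fst) / 16
  else (2 * abXhi prec k d₁ A.snd - abMlo prec k d₂ A.fst B.fst) / 16

/-- The `t′` enclosure on one `Δ′`-piece. [folklore] -/
def tpPiece (prec k : ℕ) (d₁ d₂ : ℚ) (A B : NonemptyInterval ℚ) : NonemptyInterval ℚ :=
  mkI (tpPieceLo prec k d₁ d₂ A B) (tpPieceHi prec k d₁ d₂ A B)

/-- **Inclusion property of one piece**: for `Δ′ ∈ [d₁, d₂]`, `a ∈ A` (`0 < A.fst`), `b ∈ B`,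
`t′_B(Δ′, a, b) ∈ tpPiece d₁ d₂ A B`. [folklore] -/
theorem tpB_mem_tpPiece (prec k : ℕ) {d₁ d₂ : ℚ} {A B : NonemptyInterval ℚ} (hA : 0 < A.fst)
    {Δ a b : ℝ} (hΔ : Δ ∈ Set.Icc (d₁ : ℝ) d₂) (ha : a ∈ A.ratCast ℝ) (hb : b ∈ B.ratCast ℝ) :
    tpB Δ a b ∈ (tpPiece prec k d₁ d₂ A B).ratCast ℝ := by
  rw [mem_ratCast_iff] at ha hb
  have hA' : (0 : ℝ) < (A.fst : ℝ) := by exact_mod_cast hA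
  have h1 := abXlo_le prec k d₂ A.fst
  have h2 := le_abXhi prec k d₁ A.snd
  unfold tpPiece tpPieceLo tpPieceHi
  by_cases hcond : max (B.snd * d₁) (B.snd * d₂) ≤ 2 * A.fst ^ 2 ∧
      max (B.fst * d₁) (B.fst * d₂) ≤ 2 * A.fst ^ 2
  · rw [if_pos hcond, if_pos hcond]
    have hlo : max ((B.snd : ℝ) * d₁) (B.snd * d₂) ≤ 2 * (A.fst : ℝ) ^ 2 := by
      have := hcond.1; rw [← Rat.cast_le (K := ℝ)] at this; push_cast at this; exact this
    have hhi : max ((B.fst : ℝ) * d₁) (B.fst * d₂) ≤ 2 * (A.fst : ℝ) ^ 2 := by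
      have := hcond.2; rw [← Rat.cast_le (K := ℝ)] at this; push_cast at this; exact this
    have hbox := tpB_mem_Icc_piece hA' hΔ (Set.mem_Icc.2 ha) (Set.mem_Icc.2 hb) hlo hhi
    have h3 := le_abMhi prec k d₁ A.fst B.snd
    have h4 := abMlo_le prec k d₂ A.snd B.fst
    refine mem_mkI ?_ ?_
    · push_cast; linarith [hbox.1]
    · push_cast; linarith [hbox.2]
  · rw [if_neg hcond, if_neg hcond]
    have hbox := tpB_mem_Icc_of_box_mixed hA'.le hΔ (Set.mem_Icc.2 ha) (Set.mem_Icc.2 hb)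
    have h3 := le_abMhi prec k d₁ A.snd B.snd
    have h4 := abMlo_le prec k d₂ A.fst B.fst
    refine mem_mkI ?_ ?_
    · push_cast; linarith [hbox.1]
    · push_cast; linarith [hbox.2]

/-- Hull of the `t′` piece enclosures over the uniform pieces `i = 0..n` of `[L, L + (n+1)w]`.
[folklore] -/
def tpPieces (prec k : ℕ) (L w : ℚ) (A B : NonemptyInterval ℚ) : ℕ → NonemptyInterval ℚ
  | 0 => tpPiece prec k L (L + w) A B
  | n + 1 => tpPieces prec k L w A B n ⊔ tpPiece prec k (L + (n + 1) * w) (L + (n + 2) * w) A B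

/-- **Inclusion property of the hull over pieces**: `Δ′ ∈ [L, L + (n+1)·w]`, `a ∈ A`
(`0 < A.fst`), `b ∈ B` ⇒ `t′_B ∈ tpPieces L w A B n`. [folklore] -/
theorem tpB_mem_tpPieces (prec k : ℕ) {L w : ℚ} {A B : NonemptyInterval ℚ}
    (hA : 0 < A.fst) {a b : ℝ} (ha : a ∈ A.ratCast ℝ) (hb : b ∈ B.ratCast ℝ) :
    ∀ n : ℕ, ∀ Δ : ℝ, (L : ℝ) ≤ Δ → Δ ≤ (L : ℝ) + (n + 1) * w →
      tpB Δ a b ∈ (tpPieces prec k L w A B n).ratCast ℝ := by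
  intro n
  induction n with
  | zero =>
    intro Δ h1 h2
    simp only [tpPieces]
    push_cast at h2
    refine tpB_mem_tpPiece prec k hA ⟨h1, ?_⟩ ha hb
    push_cast; linarith
  | succ n ih =>
    intro Δ h1 h2
    simp only [tpPieces]
    push_cast at h2
    by_cases hcut : Δ ≤ (L : ℝ) + (n + 1) * w
    · exact mem_ratCast_of_le le_sup_left (ih Δ h1 hcut)
    · push Not at hcut
      refine mem_ratCast_of_le le_sup_right (tpB_mem_tpPiece prec k hA ⟨?_, ?_⟩ ha hb)
      · push_cast; linarith
      · push_cast
        have : ((n : ℝ) + 1 + 1) * (w : ℝ) = ((n : ℝ) + 2) * w := by ring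
        linarith

/-- **Interval image of `t′_B` with `n + 1` uniform `Δ′`-pieces** (`Δ′ = Δ + 4t_pp′ ∈
[Δlo + 4clo, Δhi + 4chi]`). [folklore] -/
def tpIk (prec k n : ℕ) (D A B C : NonemptyInterval ℚ) : NonemptyInterval ℚ :=
  tpPieces prec k (D.fst + 4 * C.fst) (((D.snd + 4 * C.snd) - (D.fst + 4 * C.fst)) / (n + 1)) A B n

/-- **Interval image of `t″_B`** (MIXED-CORNER rule on `abS(Δ + 2t_pp′)/8 − abX(Δ′)/16 − abM(Δ′)/32`;
honest but loose — `t″` is not a load-bearing coordinate). [folklore] -/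
def tppI (prec k : ℕ) (D A B C : NonemptyInterval ℚ) : NonemptyInterval ℚ :=
  mkI (abSlo prec k (D.snd + 2 * C.snd) A.fst B.fst / 8
        - abXhi prec k (D.fst + 4 * C.fst) A.snd / 16
        - abMhi prec k (D.fst + 4 * C.fst) A.snd B.snd / 32)
    (abShi prec k (D.fst + 2 * C.fst) A.snd B.snd / 8
        - abXlo prec k (D.snd + 4 * C.snd) A.fst / 16
        - abMlo prec k (D.snd + 4 * C.snd) A.fst B.fst / 32)

/-- **Inclusion property of `tI`**: for `Δ ∈ D`, `t_pd ∈ A` (`0 ≤ A.fst`), `t_pp ∈ B`, `t_pp′ ∈ C`,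
`t_B(Δ + 4t_pp′, t_pd, t_pp) ∈ tI D A B C`. [folklore] -/
theorem tB4_mem_tI (prec k : ℕ) {D A B C : NonemptyInterval ℚ} (hA : 0 ≤ A.fst) {Δ a b c : ℝ}
    (hΔ : Δ ∈ D.ratCast ℝ) (ha : a ∈ A.ratCast ℝ) (hb : b ∈ B.ratCast ℝ) (hc : c ∈ C.ratCast ℝ) :
    tB4 Δ a b c ∈ (tI prec k D A B C).ratCast ℝ := by
  rw [mem_ratCast_iff] at hΔ ha hb hc
  have hA' : (0 : ℝ) ≤ (A.fst : ℝ) := by exact_mod_cast hA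
  have hbox := tB4_mem_Icc_of_box hA' (Set.mem_Icc.2 hΔ) (Set.mem_Icc.2 ha) (Set.mem_Icc.2 hb)
    (Set.mem_Icc.2 hc)
  have h1 := abMlo_le prec k (D.snd + 4 * C.snd) A.fst B.fst
  have h2 := le_abMhi prec k (D.fst + 4 * C.fst) A.snd B.snd
  have e1 : tB ((D.snd : ℝ) + 4 * C.snd) A.fst B.fst = abM ((D.snd : ℝ) + 4 * C.snd) A.fst B.fst / 8 :=
    rfl
  have e2 : tB ((D.fst : ℝ) + 4 * C.fst) A.snd B.snd = abM ((D.fst : ℝ) + 4 * C.fst) A.snd B.snd / 8 :=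
    rfl
  push_cast at h1 h2
  refine mem_mkI ?_ ?_
  · push_cast; linarith [hbox.1]
  · push_cast; linarith [hbox.2]

/-- **Inclusion property of `tpIk`**: for `Δ ∈ D`, `t_pd ∈ A` (`0 < A.fst`), `t_pp ∈ B`,
`t_pp′ ∈ C`, `t′_B(Δ + 4t_pp′, t_pd, t_pp) ∈ tpIk n D A B C`. [folklore] -/
theorem tpB4_mem_tpIk (prec k n : ℕ) {D A B C : NonemptyInterval ℚ} (hA : 0 < A.fst)
    {Δ a b c : ℝ} (hΔ : Δ ∈ D.ratCast ℝ) (ha : a ∈ A.ratCast ℝ) (hb : b ∈ B.ratCast ℝ)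
    (hc : c ∈ C.ratCast ℝ) : tpB4 Δ a b c ∈ (tpIk prec k n D A B C).ratCast ℝ := by
  rw [mem_ratCast_iff] at hΔ hc
  unfold tpIk tpB4
  refine tpB_mem_tpPieces prec k hA ha hb n (Δ + 4 * c) ?_ ?_
  · push_cast; linarith [hΔ.1, hc.1]
  · have hn : ((n : ℝ) + 1) ≠ 0 := by positivity
    push_cast
    field_simp
    nlinarith [hΔ.2, hc.2]

/-- **Inclusion property of `tppI`** (mixed corners). [folklore] -/
theorem tppB4_mem_tppI (prec k : ℕ) {D A B C : NonemptyInterval ℚ} (hA : 0 ≤ A.fst) {Δ a b c : ℝ}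
    (hΔ : Δ ∈ D.ratCast ℝ) (ha : a ∈ A.ratCast ℝ) (hb : b ∈ B.ratCast ℝ) (hc : c ∈ C.ratCast ℝ) :
    tppB4 Δ a b c ∈ (tppI prec k D A B C).ratCast ℝ := by
  rw [mem_ratCast_iff] at hΔ ha hb hc
  have hA' : (0 : ℝ) ≤ (A.fst : ℝ) := by exact_mod_cast hA
  have hbox := tppB4_mem_Icc_of_box_mixed hA' (Set.mem_Icc.2 hΔ) (Set.mem_Icc.2 ha)
    (Set.mem_Icc.2 hb) (Set.mem_Icc.2 hc)
  have h1 := abXlo_le prec k (D.snd + 4 * C.snd) A.fst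
  have h2 := le_abXhi prec k (D.fst + 4 * C.fst) A.snd
  have h3 := abMlo_le prec k (D.snd + 4 * C.snd) A.fst B.fst
  have h4 := le_abMhi prec k (D.fst + 4 * C.fst) A.snd B.snd
  have h5 := abSlo_le prec k (D.snd + 2 * C.snd) A.fst B.fst
  have h6 := le_abShi prec k (D.fst + 2 * C.fst) A.snd B.snd
  push_cast at h1 h2 h3 h4 h5 h6
  refine mem_mkI ?_ ?_
  · push_cast; linarith [hbox.1]
  · push_cast; linarith [hbox.2]

end Summit.Ventures.CertifiedManyBodySolver.Downfold.Emery

end
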